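import Literature.RingTheory.KTheory.KTwoRatHilbertSymbols
import Literature.RingTheory.KTheory.MilnorKModTwo
import HarnessLib

/-!
# LEMMA A.1 (Bass–Tate) for `F = ℚ`: `k₂ℚ = K₂ℚ/2K₂ℚ` is detected by the Hilbert symbols of all the completions, with
# the product formula as the only relation — the exact sequence `0 → k₂ℚ → ⊕_v {±1} → ℤ/2 → 0`
# (Milnor, *Algebraic K-theory and quadratic forms*, Appendix «K_*F/2K_*F for a global field», Lemma A.1)

Family `hodge`, lane `lit-hodgefound` (foundations library; seat `lit-hodgefound-p27`, generation 52, row g52-#3);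
topic `RingTheory/KTheory`.  Sequel of `KTwoRatHilbertSymbols` (g52-#2: Serre's `(x,y)_p` as the Steinberg symbol
`ratSignUnit p`, `= hilbertSymbol ℚ_v`; `(x,y)_∞ = archSymbol = hilbertSymbol ℚ_w`; Milnor's `((x,y))_p = ratSignUnit p`
for odd `p`; HILBERT'S PRODUCT FORMULA `finprod_hilbertSymbol_mul_prod_infinitePlace_eq_one`), of `KTwoRatMooreReciprocity`
(g52-#1: `quadCharUnits p`, its surjectivity) and of `UniversalSymbolGroupRat` (g30-#4: THEOREM 11.6 `tateHom :
U(ℚ) ≅ A₂ × ⊕_p A_p`, `directSumSubgroup`).  `U(ℚ) = UniversalSymbolGroup ℚ` is `K₂ℚ` (Matsumoto) and `K₂^M ℚ`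
(`MilnorK.twoEquiv`), and `k₂ℚ` is the tree's `MilnorK.Mod2 ℚ 2 = K₂^M ℚ / 2K₂^M ℚ` (Milnor's notation).  DEFINITIONS WITH
BODIES (plumbing: `PlaceRat`, `hilbertUnit`, `HilbertTargetRat`, `hilbertUnits`, `hilbertHomQuot`, `evalPlace`,
`prodPlaceHom`, `k2HilbertHom`) and PROVED THEOREMS; no named fact, no instance, no notation, 0 `sorry`, net debt 0 (D-0026).

## The source, verbatim

J. Milnor, *Algebraic K-theory and quadratic forms*, Invent. Math. 9 (1970) 318–344 (held `paper:doi-10-1007-bf01425486`;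
bib key `Milnor1970`), Appendix (p0024 L32–L49): «Appendix: K_*F/2K_*F for a Global Field. The arguments in this
appendix are due to Tate. Let F be a global field of characteristic ≠ 2. We will again use the abbreviation k_*F for the
algebra K_*F/2K_*F. The group k₂F has been computed by Bass and Tate as follows. **Lemma A.1.** There is an exact
sequence 0 → k₂F → ⊕ k₂F_v → Z/2Z → 0, where the summation extends over all completions F_v of F. Here the homomorphism
k₂F → k₂F_v is induced by inclusion, and the homomorphism k₂F_v → Z/2Z is injective. In fact we recall from §1 that the
group k₂F_v is cyclic of order 2, unless F_v is the complex field in which case k₂F_v is clearly zero. The composition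
k₂F → k₂F_v ⊂ Z/2Z evidently carries each generator l(a)l(b) of k₂F to either 0 or 1 according as the quadratic Hilbert
symbol (a, b)_v is trivial or not. For the proof, we refer to Bass and Tate [3].»  §1 Example 1.8 (p0005 L5–L15):
«Let F be a global field […] Let F_v range over all local or real completions of F. […] The inclusions F → F_v induce
a homomorphism K₂F → ⊕_v K₂F_v/(max. divis. subgr.), where each summand on the right is finite cyclic by 1.6 and 1.7.»

## What is formalised (the case `F = ℚ`)

For `F = ℚ` the completions are `ℚ_v` (`v : HeightOneSpectrum (𝓞 ℚ)`, all non-complex) and `ℝ` (the `Unique` infinite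
place), and each composite `k₂ℚ → k₂ℚ_v ⊂ ℤ/2` IS, by the quoted sentence, the quadratic Hilbert symbol of `ℚ_v`; we
therefore formalise the lemma with `⊕_v k₂ℚ_v` replaced by its stated value `⊕_v {±1}` (`HilbertTargetRat`, the finitely
supported families of signs indexed by the places `PlaceRat = HeightOneSpectrum (𝓞 ℚ) ⊕ InfinitePlace ℚ`), the first map
by the vector of Hilbert symbols and the last by the product of all components — the identification `k₂ℚ_v ≅ ℤ/2` of the
local groups themselves (EXAMPLES 1.6/1.7, Moore) is not needed and not formalised (for `ℝ` it is the tree's `kRealEquiv`).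
* §1 `hilbertUnit 𝔭 x y ∈ ℤˣ`, the Hilbert symbol of `x, y ∈ ℚˣ` in the completion at the place `𝔭` (`coe_hilbertUnit_inl/inr`:
  it IS `hilbertSymbol (v.adicCompletion ℚ)` / `hilbertSymbol w.Completion`), a Steinberg symbol at every place
  (`isSteinbergSymbol_hilbertUnit`), non-trivial at finitely many places (`finite_setOf_hilbertUnit_ne_one`).
* §2 the joint symbol `hilbertUnits x y ∈ ⊕_𝔭 {±1}` and its homomorphism **`hilbertHomQuot : U(ℚ) → ⊕_𝔭 {±1}`**
  («carries each generator l(a)l(b) … to … the quadratic Hilbert symbol (a,b)_v», `hilbertHomQuot_univSymbol`); its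
  components in the coordinates of THEOREM 11.6 (`evalPlace_inr_comp_hilbertHomQuot` = the archimedean symbol,
  `…_inl_…_of_eq_two` = the `2`-adic symbol, `…_inl_…_of_ne_two` = `χ_p` of the tame symbol).
* §3 the last map `prodPlaceHom : ⊕_𝔭 {±1} → {±1}`, `g ↦ (∏ᶠ_{v finite} g_v) · ∏_{w infinite} g_w`, onto
  (`prodPlaceHom_surjective`), and the PRODUCT FORMULA `prodPlaceHom ∘ hilbertHomQuot = 1` (`prodPlaceHom_comp_hilbertHomQuot`).
* §4 **LEMMA A.1 for `ℚ` on `U(ℚ) = K₂ℚ`**: **`hilbertHomQuot_eq_one_iff_isSquare`** (an element of `K₂ℚ` with all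
  Hilbert symbols trivial is a square — via THEOREM 11.6: its `2`-adic symbol is `1` and its tame symbols are squares in
  the `(ℤ/p)ˣ`, `χ_p` detecting squares), i.e. `ker hilbertHomQuot = K₂ℚ²` (`ker_hilbertHomQuot_eq_range_sq`), and
  **`ker_prodPlaceHom_eq_range_hilbertHomQuot`** (a family of signs with product `1` is the family of Hilbert symbols of
  some element — built with THEOREM 11.6 from prescribed non-residues, the archimedean sign being then forced by the
  product formula).
* §5 **LEMMA A.1 for `ℚ` on `k₂ℚ = K₂^M ℚ/2K₂^M ℚ`** (`MilnorK.Mod2 ℚ 2`): the induced additive map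
  **`k2HilbertHom : k₂ℚ →+ Additive (⊕_𝔭 {±1})`**, `{a, b} ↦ ((a,b)_𝔭)_𝔭` (`k2HilbertHom_kSymbol`), is INJECTIVE
  (**`k2HilbertHom_injective`**: «0 → k₂F → ⊕ k₂F_v» exact), its range is the kernel of the product map
  (**`range_k2HilbertHom_eq_ker`**: exact at `⊕ k₂F_v`), and the product map is onto `{±1} ≅ ℤ/2` («→ Z/2Z → 0»):
  `lemmaA1_rat` packages the three.

## References

* [Milnor1970] J. Milnor, *Algebraic K-theory and quadratic forms*, Invent. Math. 9 (1970) 318–344 — Appendix, Lemma A.1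
  (p. 341, p0024 L32–L49); §1 Example 1.8 (p. 322, p0005 L5–L15).
* [BassTate1973] H. Bass, J. Tate, *The Milnor ring of a global field*, in: Algebraic K-theory II, Lecture Notes in Math.
  342, Springer (1973) 349–446 — Milnor's reference [3] «K₂ of global fields (in preparation)» for Lemma A.1; cited
  through [Milnor1970].
* [Serre1973] J.-P. Serre, *A Course in Arithmetic*, GTM 7 (1973), Ch. III §2.1 Theorem 3 — the product formula consumed
  from g52-#2.

Provenance: lane `lit-hodgefound`, seat `lit-hodgefound-p27` gen 52 (agent `literature-prover-lit-hodgefound-p27-g52-0`),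
row g52-#3.
-/

set_option autoImplicit false

noncomputable section

namespace Literature.RingTheory.KTheory

open SteinbergGroup
open Literature.NumberTheory.QuadraticForms
open IsDedekindDomain NumberField Rat.HeightOneSpectrum

/-! ### §1 The Hilbert symbol `(x,y)_𝔭 ∈ {±1}` at a place `𝔭` of `ℚ` -/

section Places

/-- **The places of `ℚ`**: the finite places `v` (completions `ℚ_v = ℚ_p`) and the infinite place (completion `ℝ`), as
the sum type used by the tree's `HilbertSymbolPlaces.lean` («the summation extends over all completions F_v of F»).
[cite: Milnor1970, Appendix Lemma A.1 (p0024 L38–L40); §1 Example 1.8 «Let F_v range over all local or real completions of F» (p0005 L7)] -/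
abbrev PlaceRat : Type := HeightOneSpectrum (𝓞 ℚ) ⊕ InfinitePlace ℚ

/-- **The quadratic Hilbert symbol `(x,y)_𝔭 ∈ {±1}` of `x, y ∈ ℚˣ` in the completion at the place `𝔭`**, as a unit of `ℤ`:
at a finite place `v ∣ p` Serre's `(x,y)_p` (`ratSignUnit p`, which is `hilbertSymbol ℚ_v` — `coe_hilbertUnit_inl`), at
the infinite place `(x,y)_∞` (`archSymbol`, which is `hilbertSymbol ℝ` — `coe_hilbertUnit_inr`).  Its integer value is the
`placeSymbol x y 𝔭` of `HilbertSymbolPlaces.lean` (not imported here).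
[cite: Milnor1970, Appendix Lemma A.1 «the quadratic Hilbert symbol (a, b)_v» (p0024 L44–L46)] -/
def hilbertUnit : PlaceRat → ℚˣ → ℚˣ → ℤˣ
  | Sum.inl v => @ratSignUnit (natGenerator v) ⟨prime_natGenerator v⟩
  | Sum.inr _ => archSymbol

/-- At a finite place: `(x,y)_v = hilbertSymbol ℚ_v x y`. [cite: Milnor1970, Appendix Lemma A.1 (p0024 L44–L46)] -/
theorem coe_hilbertUnit_inl (v : HeightOneSpectrum (𝓞 ℚ)) (x y : ℚˣ) :
    ((hilbertUnit (Sum.inl v) x y : ℤˣ) : ℤ) =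
      hilbertSymbol (v.adicCompletion ℚ) (algebraMap ℚ _ (x : ℚ)) (algebraMap ℚ _ (y : ℚ)) :=
  @coe_ratSignUnit_eq_hilbertSymbol _ ⟨prime_natGenerator v⟩ v rfl x y

/-- At the infinite place: `(x,y)_w = hilbertSymbol ℚ_w x y` (`ℚ_w ≅ ℝ`). [cite: Milnor1970, Appendix Lemma A.1 (p0024 L44–L46)] -/
theorem coe_hilbertUnit_inr (w : InfinitePlace ℚ) (x y : ℚˣ) :
    ((hilbertUnit (Sum.inr w) x y : ℤˣ) : ℤ) = hilbertSymbol w.Completion (algebraMap ℚ _ (x : ℚ)) (algebraMap ℚ _ (y : ℚ)) :=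
  coe_archSymbol_eq_hilbertSymbol w x y

/-- The infinite component is Milnor's `(x,y)_∞ = archSymbol`. [cite: Milnor1972, §11 (chunk p0068 L27–L31)] -/
theorem hilbertUnit_inr (w : InfinitePlace ℚ) : hilbertUnit (Sum.inr w) = archSymbol := rfl

/-- At the place over `2` the symbol is Milnor's `(x,y)_2 = dyadicSymbol`. [cite: Milnor1972, §11 (chunk p0068 L37–L39)] -/
theorem hilbertUnit_inl_of_eq_two (v : HeightOneSpectrum (𝓞 ℚ)) (hv : natGenerator v = 2) (x y : ℚˣ) :
    hilbertUnit (Sum.inl v) x y = dyadicSymbol x y :=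
  Units.ext (by rw [coe_hilbertUnit_inl, coe_dyadicSymbol_eq_hilbertSymbol v hv])

/-- At a place over an odd `p` the symbol is Milnor's `((x,y))_p = χ_p((x,y)_p)`. [cite: Milnor1972, §11 (chunk p0068 L37–L41)] -/
theorem hilbertUnit_inl_of_ne_two (v : HeightOneSpectrum (𝓞 ℚ)) (hv2 : natGenerator v ≠ 2) (x y : ℚˣ) :
    hilbertUnit (Sum.inl v) x y = hilbertSymbolAt (primesEquiv v) x y :=
  Units.ext (by rw [coe_hilbertUnit_inl, coe_hilbertSymbolAt_eq_hilbertSymbol v hv2])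

/-- **`(x,y)_𝔭` is a Steinberg symbol at every place.** [cite: Milnor1970, Appendix «φ is … multiplicative in each variable, and φ(a_1, …, a_n) = 1 whenever a_1 + a_2 = 1» (p0025 L14–L17)] -/
theorem isSteinbergSymbol_hilbertUnit (P : PlaceRat) : IsSteinbergSymbol (hilbertUnit P) := by
  rcases P with v | w
  · exact @isSteinbergSymbol_ratSignUnit _ ⟨prime_natGenerator v⟩
  · exact isSteinbergSymbol_archSymbol

/-- **Only finitely many places have `(x,y)_𝔭 ≠ 1`** (so the joint symbol lands in the direct SUM).
[cite: Serre1973, Ch. III §2.1 Theorem 3 «(a, b)_v = 1 for almost all v ∈ V» (chunk p0023 L19–L21)] -/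
theorem finite_setOf_hilbertUnit_ne_one (x y : ℚˣ) : {P : PlaceRat | hilbertUnit P x y ≠ 1}.Finite := by
  have h1 : (Set.range (Sum.inr : InfinitePlace ℚ → PlaceRat)).Finite := Set.finite_range _
  have h2 : ((Sum.inl : HeightOneSpectrum (𝓞 ℚ) → PlaceRat) ''
      (Function.mulSupport fun v : HeightOneSpectrum (𝓞 ℚ) =>
        hilbertSymbol (v.adicCompletion ℚ) (algebraMap ℚ _ (x : ℚ)) (algebraMap ℚ _ (y : ℚ)))).Finite :=
    (finite_mulSupport_hilbertSymbol_rat x y).image _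
  refine (h2.union h1).subset ?_
  rintro (v | w) hv
  · refine Or.inl ⟨v, ?_, rfl⟩
    rw [Function.mem_mulSupport, ← coe_hilbertUnit_inl]
    exact fun h => hv (Units.ext h)
  · exact Or.inr ⟨w, rfl⟩

end Places

/-! ### §2 The joint symbol `U(ℚ) → ⊕_𝔭 {±1}`, `c(x,y) ↦ ((x,y)_𝔭)_𝔭` -/

section Joint

/-- **`⊕_v k₂ℚ_v` with its stated value: the finitely supported families of signs indexed by the places of `ℚ`.**
[cite: Milnor1970, Appendix Lemma A.1 «⊕ k₂F_v … k₂F_v is cyclic of order 2» (p0024 L38–L43)] -/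
abbrev HilbertTargetRat : Type := ↥(directSumSubgroup fun _ : PlaceRat => ℤˣ)

/-- The joint Hilbert symbol `((x,y)_𝔭)_𝔭 ∈ ⊕_𝔭 {±1}`. [cite: Milnor1970, Appendix Lemma A.1 (p0024 L44–L46)] -/
def hilbertUnits (x y : ℚˣ) : HilbertTargetRat := ⟨fun P => hilbertUnit P x y, finite_setOf_hilbertUnit_ne_one x y⟩

/-- Components of the joint symbol. [cite: Milnor1970, Appendix Lemma A.1 (p0024 L44–L46)] -/
@[simp] theorem coe_hilbertUnits_apply (x y : ℚˣ) (P : PlaceRat) :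
    ((hilbertUnits x y : HilbertTargetRat) : PlaceRat → ℤˣ) P = hilbertUnit P x y := rfl

/-- The joint symbol is a Steinberg symbol. [cite: Milnor1970, Appendix (p0025 L14–L17)] -/
theorem isSteinbergSymbol_hilbertUnits : IsSteinbergSymbol hilbertUnits where
  mul_left x₁ x₂ y := Subtype.ext (funext fun P => (isSteinbergSymbol_hilbertUnit P).mul_left x₁ x₂ y)
  mul_right x y₁ y₂ := Subtype.ext (funext fun P => (isSteinbergSymbol_hilbertUnit P).mul_right x y₁ y₂)
  eq_one_of_add_eq_one x y h := Subtype.ext (funext fun P => (isSteinbergSymbol_hilbertUnit P).eq_one_of_add_eq_one x y h)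

/-- **The first homomorphism of LEMMA A.1 on `U(ℚ) = K₂ℚ`**: `c(x,y) ↦ ((x,y)_𝔭)_𝔭`.
[cite: Milnor1970, Appendix Lemma A.1 «the homomorphism k₂F → k₂F_v is induced by inclusion … carries each generator l(a)l(b) … to … the quadratic Hilbert symbol (a, b)_v» (p0024 L40–L46)] -/
def hilbertHomQuot : UniversalSymbolGroup ℚ →* HilbertTargetRat := isSteinbergSymbol_hilbertUnits.lift

/-- `hilbertHomQuot c(x,y) = ((x,y)_𝔭)_𝔭`. [cite: Milnor1970, Appendix Lemma A.1 (p0024 L44–L46)] -/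
@[simp] theorem hilbertHomQuot_univSymbol (x y : ℚˣ) : hilbertHomQuot (univSymbol x y) = hilbertUnits x y :=
  isSteinbergSymbol_hilbertUnits.lift_univSymbol x y

/-- The component at a place, `⊕_𝔭 {±1} → {±1}`. [cite: Milnor1970, Appendix Lemma A.1 (p0024 L40–L44)] -/
def evalPlace (P : PlaceRat) : HilbertTargetRat →* ℤˣ :=
  (Pi.evalMonoidHom (fun _ : PlaceRat => ℤˣ) P).comp (directSumSubgroup fun _ : PlaceRat => ℤˣ).subtype

/-- Unfolding `evalPlace`. [cite: Milnor1970, Appendix Lemma A.1 (p0024 L40–L44)] -/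
theorem evalPlace_apply (P : PlaceRat) (g : HilbertTargetRat) : evalPlace P g = (g : PlaceRat → ℤˣ) P := rfl

/-- Every element of `⊕_𝔭 {±1}` has square `1`. [cite: Milnor1970, Appendix Lemma A.1 «cyclic of order 2» (p0024 L42)] -/
theorem HilbertTargetRat.mul_self (g : HilbertTargetRat) : g * g = 1 :=
  Subtype.ext (funext fun _ => Int.units_mul_self _)

/-- **The infinite component of `hilbertHomQuot` is the archimedean symbol** (`= placeHomRat`'s first component).
[cite: Milnor1972, §11 (chunk p0068 L27–L31); Milnor1970, Appendix Lemma A.1 (p0024 L44–L46)] -/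
theorem evalPlace_inr_comp_hilbertHomQuot (w : InfinitePlace ℚ) :
    (evalPlace (Sum.inr w)).comp hilbertHomQuot = (MonoidHom.fst ℤˣ TateTarget).comp placeHomRat :=
  UniversalSymbolGroup.hom_ext fun x y => by
    rw [MonoidHom.comp_apply, hilbertHomQuot_univSymbol, evalPlace_apply, coe_hilbertUnits_apply, hilbertUnit_inr,
      MonoidHom.comp_apply, placeHomRat_univSymbol, MonoidHom.coe_fst, placeSymbolsRat_fst]

/-- **The component of `hilbertHomQuot` at the place over `2` is the `2`-adic symbol** (THEOREM 11.6's `A₂`-coordinate).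
[cite: Milnor1972, §11 Theorem 11.6 (chunk p0067 L9–L15); Milnor1970, Appendix Lemma A.1 (p0024 L44–L46)] -/
theorem evalPlace_inl_comp_hilbertHomQuot_of_eq_two (v : HeightOneSpectrum (𝓞 ℚ)) (hv : natGenerator v = 2) :
    (evalPlace (Sum.inl v)).comp hilbertHomQuot = (MonoidHom.fst ℤˣ _).comp tateHom :=
  UniversalSymbolGroup.hom_ext fun x y => by
    rw [MonoidHom.comp_apply, hilbertHomQuot_univSymbol, evalPlace_apply, coe_hilbertUnits_apply,
      hilbertUnit_inl_of_eq_two v hv, MonoidHom.comp_apply, tateHom_univSymbol, MonoidHom.coe_fst, localSymbols_fst]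

/-- **The component of `hilbertHomQuot` at a place over an odd `p` is `χ_p` of the tame symbol** (THEOREM 11.6's
`A_p`-coordinate followed by `μ(ℚ_p) → {±1}`). [cite: Milnor1972, §11 «((x,y))_p ≡ (x,y)_p^{(p−1)/2} mod p» (chunk p0068 L37–L41); Milnor1970, Appendix Lemma A.1 (p0024 L44–L46)] -/
theorem evalPlace_inl_comp_hilbertHomQuot_of_ne_two (v : HeightOneSpectrum (𝓞 ℚ)) (hv2 : natGenerator v ≠ 2) :
    (evalPlace (Sum.inl v)).comp hilbertHomQuot =
      (quadCharUnitsAt (primesEquiv v)).comp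
        ((Pi.evalMonoidHom (fun q : Nat.Primes => (ZMod (q : ℕ))ˣ) (primesEquiv v)).comp
          ((directSumSubgroup fun q : Nat.Primes => (ZMod (q : ℕ))ˣ).subtype.comp ((MonoidHom.snd ℤˣ _).comp tateHom))) :=
  UniversalSymbolGroup.hom_ext fun x y => by
    rw [MonoidHom.comp_apply, hilbertHomQuot_univSymbol, evalPlace_apply, coe_hilbertUnits_apply,
      hilbertUnit_inl_of_ne_two v hv2, hilbertSymbolAt_def]
    simp only [MonoidHom.comp_apply, tateHom_univSymbol, MonoidHom.coe_snd, Subgroup.coe_subtype, Pi.evalMonoidHom_apply,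
      coe_localSymbols_snd]

end Joint

/-! ### §3 The last map `⊕_𝔭 {±1} → {±1}`, product of all components, and the product formula -/

section ProductMap

/-- The finite components of an element of `⊕_𝔭 {±1}` are finitely supported. [cite: Milnor1970, Appendix Lemma A.1 (p0024 L38–L40)] -/
theorem HilbertTargetRat.hasFiniteMulSupport_inl (g : HilbertTargetRat) :
    (fun v : HeightOneSpectrum (𝓞 ℚ) => (g : PlaceRat → ℤˣ) (Sum.inl v)).HasFiniteMulSupport :=
  (g.2.preimage Sum.inl_injective.injOn).subset fun _ hv => hv

/-- **The last homomorphism of LEMMA A.1, `⊕_v k₂F_v → ℤ/2`**: the product of all the components,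
`g ↦ (∏ᶠ_{v finite} g_v) · ∏_{w infinite} g_w` (each `k₂ℚ_v → ℤ/2` being injective, the sum of the local invariants).
[cite: Milnor1970, Appendix Lemma A.1 «the homomorphism k₂F_v → Z/2Z is injective» (p0024 L38–L41)] -/
def prodPlaceHom : HilbertTargetRat →* ℤˣ where
  toFun g := (∏ᶠ v : HeightOneSpectrum (𝓞 ℚ), (g : PlaceRat → ℤˣ) (Sum.inl v)) *
    ∏ w : InfinitePlace ℚ, (g : PlaceRat → ℤˣ) (Sum.inr w)
  map_one' := by
    simp only [OneMemClass.coe_one, Pi.one_apply, finprod_one, Finset.prod_const_one, mul_one]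
  map_mul' g h := by
    rw [mul_mul_mul_comm, ← finprod_mul_distrib g.hasFiniteMulSupport_inl h.hasFiniteMulSupport_inl, ← Finset.prod_mul_distrib]
    rfl

/-- Unfolding `prodPlaceHom`. [cite: Milnor1970, Appendix Lemma A.1 (p0024 L38–L41)] -/
theorem prodPlaceHom_apply (g : HilbertTargetRat) :
    prodPlaceHom g = (∏ᶠ v : HeightOneSpectrum (𝓞 ℚ), (g : PlaceRat → ℤˣ) (Sum.inl v)) *
      ∏ w : InfinitePlace ℚ, (g : PlaceRat → ℤˣ) (Sum.inr w) := rfl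

/-- With the unique infinite place made explicit: `prodPlaceHom g = (∏ᶠ_v g_v) · g_∞`.
[cite: Milnor1970, Appendix Lemma A.1 (p0024 L38–L41)] -/
theorem prodPlaceHom_eq (g : HilbertTargetRat) :
    prodPlaceHom g = (∏ᶠ v : HeightOneSpectrum (𝓞 ℚ), (g : PlaceRat → ℤˣ) (Sum.inl v)) *
      (g : PlaceRat → ℤˣ) (Sum.inr default) := by
  rw [prodPlaceHom_apply, Fintype.prod_unique]

/-- **The product map is onto `{±1}`** (exactness of LEMMA A.1 at `ℤ/2`: «→ Z/2Z → 0»).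
[cite: Milnor1970, Appendix Lemma A.1 (p0024 L38–L39)] -/
theorem prodPlaceHom_surjective : Function.Surjective prodPlaceHom := by
  intro s
  -- the family supported at the infinite place with value `s`
  have hmem : (Sum.elim (fun _ => 1) (fun _ => s) : PlaceRat → ℤˣ) ∈ directSumSubgroup fun _ : PlaceRat => ℤˣ := by
    refine (Set.finite_range (Sum.inr : InfinitePlace ℚ → PlaceRat)).subset ?_
    rintro (v | w) hv
    · exact absurd (Sum.elim_inl _ _ v) hv
    · exact ⟨w, rfl⟩
  refine ⟨⟨Sum.elim (fun _ => 1) (fun _ => s), hmem⟩, ?_⟩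
  rw [prodPlaceHom_eq]
  simp only [Sum.elim_inl, Sum.elim_inr, finprod_one, one_mul]

/-- **The product formula on the joint symbol**: `∏_𝔭 (x,y)_𝔭 = 1` (Hilbert's Theorem 3, from g52-#2).
[cite: Serre1973, Ch. III §2.1 Theorem 3 (chunk p0023 L19); Milnor1970, Appendix Lemma A.1 (p0024 L38–L39)] -/
theorem prodPlaceHom_hilbertUnits (x y : ℚˣ) : prodPlaceHom (hilbertUnits x y) = 1 := by
  refine Units.ext ?_
  rw [prodPlaceHom_apply, Units.val_mul, Units.val_one, ← Units.coeHom_apply (∏ᶠ v : HeightOneSpectrum (𝓞 ℚ), _),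
    MonoidHom.map_finprod _ (hilbertUnits x y).hasFiniteMulSupport_inl, ← Units.coeHom_apply (∏ w : InfinitePlace ℚ, _),
    map_prod, ← finprod_hilbertSymbol_mul_prod_infinitePlace_eq_one x y]
  simp only [Units.coeHom_apply, coe_hilbertUnits_apply, coe_hilbertUnit_inl, coe_hilbertUnit_inr]

/-- **`prodPlaceHom ∘ hilbertHomQuot = 1`**: the Hilbert symbols of an element of `K₂ℚ` multiply to `1` (the sequence of
LEMMA A.1 is a complex at `⊕_v k₂F_v`). [cite: Milnor1970, Appendix Lemma A.1 (p0024 L38–L39); Serre1973, Ch. III §2.1 Theorem 3] -/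
theorem prodPlaceHom_comp_hilbertHomQuot : prodPlaceHom.comp hilbertHomQuot = 1 :=
  UniversalSymbolGroup.hom_ext fun x y => by
    rw [MonoidHom.comp_apply, hilbertHomQuot_univSymbol, prodPlaceHom_hilbertUnits, MonoidHom.one_apply]

end ProductMap

/-! ### §4 LEMMA A.1 for `ℚ` on `U(ℚ) = K₂ℚ`: kernel `K₂ℚ²`, image the families with product `1` -/

section LemmaA1

/-- The place of `ℚ` over `2`. [cite: Milnor1972, §11 Theorem 11.6, the summand `A₂` (chunk p0067 L9–L11)] -/
theorem natGenerator_primesEquiv_symm_two : natGenerator ((primesEquiv (R := 𝓞 ℚ)).symm ⟨2, Nat.prime_two⟩) = 2 :=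
  congrArg Subtype.val ((primesEquiv (R := 𝓞 ℚ)).apply_symm_apply ⟨2, Nat.prime_two⟩)

/-- A unit of `ℤ/pℤ` on which the quadratic character is `1` is a square of a unit.
[cite: Milnor1972, §11 «((x,y))_p ≡ (x,y)_p^{(p−1)/2} mod p» (chunk p0068 L37–L41)] -/
theorem exists_mul_self_eq_of_quadCharUnits_eq_one (p : ℕ) [Fact p.Prime] {u : (ZMod p)ˣ} (hu : quadCharUnits p u = 1) :
    ∃ r : (ZMod p)ˣ, r * r = u := by
  have hu' : quadraticChar (ZMod p) (u : ZMod p) = 1 := by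
    rw [← coe_quadCharUnits, hu, Units.val_one]
  obtain ⟨r, hr⟩ := (quadraticChar_one_iff_isSquare u.ne_zero).1 hu'
  have hr0 : r ≠ 0 := fun h => u.ne_zero (by rw [hr, h, mul_zero])
  exact ⟨Units.mk0 r hr0, Units.ext (by rw [Units.val_mul, Units.val_mk0, ← hr])⟩

/-- **LEMMA A.1 for `ℚ`, exactness at `k₂ℚ`: an element of `K₂ℚ` all of whose Hilbert symbols are trivial is a square**
(and conversely).  Proof through THEOREM 11.6: its `2`-adic symbol is `1`, and at each odd `p` its tame symbol has
`χ_p = 1`, so is a square `r_p²` in `(ℤ/p)ˣ`; the element with Tate coordinates `(1, (r_p)_p)` is a square root.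
[cite: Milnor1970, Appendix Lemma A.1 «0 → k₂F → ⊕ k₂F_v» (p0024 L38–L39); Milnor1972, §11 Theorem 11.6 (chunk p0067 L9–L15)] -/
theorem hilbertHomQuot_eq_one_iff_isSquare (a : UniversalSymbolGroup ℚ) : hilbertHomQuot a = 1 ↔ IsSquare a := by
  constructor
  · intro ha
    -- the Tate coordinates of `a`
    have h2 : (tateHom a).1 = 1 := by
      have := DFunLike.congr_fun (evalPlace_inl_comp_hilbertHomQuot_of_eq_two _ natGenerator_primesEquiv_symm_two) a
      rw [MonoidHom.comp_apply, ha, map_one, MonoidHom.comp_apply, MonoidHom.coe_fst] at this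
      exact this.symm
    have hodd : ∀ p : Nat.Primes, ∃ r : (ZMod (p : ℕ))ˣ,
        r * r = ((tateHom a).2 : (q : Nat.Primes) → (ZMod (q : ℕ))ˣ) p := by
      intro p
      haveI : Fact (p : ℕ).Prime := ⟨p.2⟩
      by_cases hp2 : (p : ℕ) = 2
      · -- `(ℤ/2)ˣ` is trivial
        obtain ⟨q, hq⟩ := p
        change q = 2 at hp2
        subst hp2
        exact ⟨1, Subsingleton.elim _ _⟩
      · refine exists_mul_self_eq_of_quadCharUnits_eq_one (p : ℕ) ?_
        have hgen : natGenerator ((primesEquiv (R := 𝓞 ℚ)).symm p) ≠ 2 := by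
          rwa [show natGenerator ((primesEquiv (R := 𝓞 ℚ)).symm p) = p from
            congrArg Subtype.val ((primesEquiv (R := 𝓞 ℚ)).apply_symm_apply p)]
        have := DFunLike.congr_fun (evalPlace_inl_comp_hilbertHomQuot_of_ne_two _ hgen) a
        rw [MonoidHom.comp_apply, ha, map_one, Equiv.apply_symm_apply] at this
        rw [← quadCharUnitsAt_eq]
        exact this.symm
    choose r hr using hodd
    -- a finitely supported square root of the tame coordinates
    classical
    let s : (p : Nat.Primes) → (ZMod (p : ℕ))ˣ := fun p =>
      if ((tateHom a).2 : (q : Nat.Primes) → (ZMod (q : ℕ))ˣ) p = 1 then 1 else r p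
    have hs : ∀ p, s p * s p = ((tateHom a).2 : (q : Nat.Primes) → (ZMod (q : ℕ))ˣ) p := by
      intro p
      by_cases h1 : ((tateHom a).2 : (q : Nat.Primes) → (ZMod (q : ℕ))ˣ) p = 1
      · simp only [s, h1, if_true, mul_one]
      · simp only [s, h1, if_false, hr p]
    have hsmem : s ∈ directSumSubgroup fun q : Nat.Primes => (ZMod (q : ℕ))ˣ := by
      refine Set.Finite.subset (tateHom a).2.2 fun p hp => ?_
      intro h1
      exact hp (by simp only [s, h1, if_true])
    obtain ⟨b, hb⟩ := tateHom_surjective ((1 : ℤˣ), ⟨s, hsmem⟩)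
    refine ⟨b, tateHom_injective ?_⟩
    rw [map_mul, hb]
    exact Prod.ext (by rw [Prod.fst_mul, one_mul, h2]) (Subtype.ext (funext fun p => by
      rw [Prod.snd_mul, Subgroup.coe_mul, Pi.mul_apply]
      exact (hs p).symm))
  · rintro ⟨b, rfl⟩
    rw [map_mul, HilbertTargetRat.mul_self]

/-- `ker hilbertHomQuot = K₂ℚ²`, the range of the squaring homomorphism. [cite: Milnor1970, Appendix Lemma A.1 (p0024 L38–L39)] -/
theorem ker_hilbertHomQuot_eq_range_sq : hilbertHomQuot.ker = (powMonoidHom 2 : UniversalSymbolGroup ℚ →* _).range := by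
  ext a
  rw [MonoidHom.mem_ker, hilbertHomQuot_eq_one_iff_isSquare, MonoidHom.mem_range]
  constructor
  · rintro ⟨b, rfl⟩
    exact ⟨b, by rw [powMonoidHom_apply, pow_two]⟩
  · rintro ⟨b, rfl⟩
    exact ⟨b, by rw [powMonoidHom_apply, pow_two]⟩

/-- **LEMMA A.1 for `ℚ`, exactness at `⊕_v k₂ℚ_v`: a finitely supported family of signs with product `1` is the family of
Hilbert symbols of an element of `K₂ℚ`.**  Construction through THEOREM 11.6: prescribe the `2`-adic symbol and, at
each odd `p`, the tame symbol `1` or a non-residue according to the sign wanted; the sign at `∞` is then forced.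
[cite: Milnor1970, Appendix Lemma A.1 «⊕ k₂F_v → Z/2Z» exact (p0024 L38–L39); Milnor1972, §11 Theorem 11.6 (chunk p0067 L9–L15)] -/
theorem ker_prodPlaceHom_eq_range_hilbertHomQuot : prodPlaceHom.ker = hilbertHomQuot.range := by
  classical
  refine le_antisymm (fun g hg => ?_) fun g hg => ?_
  · rw [MonoidHom.mem_ker] at hg
    -- a non-residue at each odd prime
    have hnr : ∀ p : Nat.Primes, (p : ℕ) ≠ 2 → ∃ u : (ZMod (p : ℕ))ˣ, quadCharUnitsAt p u = -1 := by
      intro p hp2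
      haveI : Fact (p : ℕ).Prime := ⟨p.2⟩
      exact quadCharUnits_surjective (p : ℕ) hp2 (-1)
    -- the prescribed Tate coordinates
    let e : PlaceRat → ℤˣ := (g : PlaceRat → ℤˣ)
    let t : (p : Nat.Primes) → (ZMod (p : ℕ))ˣ := fun p =>
      if hp2 : (p : ℕ) = 2 then 1 else
        if e (Sum.inl ((primesEquiv (R := 𝓞 ℚ)).symm p)) = 1 then 1 else (hnr p hp2).choose
    have htmem : t ∈ directSumSubgroup fun q : Nat.Primes => (ZMod (q : ℕ))ˣ := by
      refine ((g.hasFiniteMulSupport_inl.image (primesEquiv (R := 𝓞 ℚ))).subset fun p hp => ?_)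
      refine ⟨(primesEquiv (R := 𝓞 ℚ)).symm p, ?_, Equiv.apply_symm_apply _ _⟩
      rw [Function.mem_mulSupport]
      intro h1
      apply hp
      by_cases hp2 : (p : ℕ) = 2
      · simp only [t, hp2, dif_pos]
      · simp only [t, hp2, dif_neg, not_false_eq_true, e, h1, if_true]
    obtain ⟨a, ha⟩ := tateHom_surjective (e (Sum.inl ((primesEquiv (R := 𝓞 ℚ)).symm ⟨2, Nat.prime_two⟩)), ⟨t, htmem⟩)
    -- the finite components of `hilbertHomQuot a` are those of `g`
    have hfin : ∀ v : HeightOneSpectrum (𝓞 ℚ),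
        ((hilbertHomQuot a : HilbertTargetRat) : PlaceRat → ℤˣ) (Sum.inl v) = e (Sum.inl v) := by
      intro v
      by_cases hv : natGenerator v = 2
      · have hv' : v = (primesEquiv (R := 𝓞 ℚ)).symm ⟨2, Nat.prime_two⟩ := by
          rw [Equiv.eq_symm_apply]; exact Subtype.ext hv
        have := DFunLike.congr_fun (evalPlace_inl_comp_hilbertHomQuot_of_eq_two v hv) a
        rw [MonoidHom.comp_apply, evalPlace_apply, MonoidHom.comp_apply, MonoidHom.coe_fst, ha] at this
        rw [this, hv']
      · have := DFunLike.congr_fun (evalPlace_inl_comp_hilbertHomQuot_of_ne_two v hv) a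
        rw [MonoidHom.comp_apply, evalPlace_apply] at this
        rw [this]
        simp only [MonoidHom.comp_apply, MonoidHom.coe_snd, ha, Subgroup.coe_subtype, Pi.evalMonoidHom_apply]
        have hp2 : ((primesEquiv (R := 𝓞 ℚ) v : Nat.Primes) : ℕ) ≠ 2 := hv
        simp only [t, hp2, dif_neg, not_false_eq_true, Equiv.symm_apply_apply]
        by_cases h1 : e (Sum.inl v) = 1
        · rw [if_pos h1, map_one, h1]
        · rw [if_neg h1, (hnr _ hp2).choose_spec]
          rcases Int.units_eq_one_or (e (Sum.inl v)) with h | h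
          · exact absurd h h1
          · exact h.symm
    -- the infinite component is forced by the two product formulas
    have hinf : ((hilbertHomQuot a : HilbertTargetRat) : PlaceRat → ℤˣ) (Sum.inr default) = e (Sum.inr default) := by
      have h1 : prodPlaceHom (hilbertHomQuot a) = 1 := by
        rw [← MonoidHom.comp_apply, prodPlaceHom_comp_hilbertHomQuot, MonoidHom.one_apply]
      rw [prodPlaceHom_eq, finprod_congr hfin] at h1
      rw [prodPlaceHom_eq] at hg
      exact mul_left_cancel (h1.trans hg.symm)
    refine ⟨a, Subtype.ext (funext fun P => ?_)⟩
    rcases P with v | w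
    · exact hfin v
    · rw [Unique.eq_default w]; exact hinf
  · obtain ⟨a, rfl⟩ := hg
    rw [MonoidHom.mem_ker, ← MonoidHom.comp_apply, prodPlaceHom_comp_hilbertHomQuot, MonoidHom.one_apply]

end LemmaA1

/-! ### §5 LEMMA A.1 for `ℚ` on `k₂ℚ = K₂^M ℚ / 2 K₂^M ℚ` -/

section ModTwo

open MilnorK

/-- The Hilbert symbols on `K₂^M ℚ` (through `twoEquiv : K₂^M ℚ ≅ U(ℚ)`), additively. [cite: Milnor1970, Appendix Lemma A.1 (p0024 L40–L46)] -/
def milnorKHilbertHom : MilnorK ℚ 2 →+ Additive HilbertTargetRat :=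
  (MonoidHom.toAdditive hilbertHomQuot).comp (twoEquiv ℚ).toAddMonoidHom

/-- On symbols: `{x, y} ↦ ((x,y)_𝔭)_𝔭`. [cite: Milnor1970, Appendix Lemma A.1 «carries each generator l(a)l(b) …» (p0024 L44–L46)] -/
theorem milnorKHilbertHom_symbol (x y : ℚˣ) :
    milnorKHilbertHom (symbol ![x, y]) = Additive.ofMul (hilbertUnits x y) := by
  rw [milnorKHilbertHom, AddMonoidHom.comp_apply, AddEquiv.coe_toAddMonoidHom, twoEquiv_symbol,
    MonoidHom.toAdditive_apply_apply, toMul_ofMul, hilbertHomQuot_univSymbol]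

/-- `2K₂^M ℚ` is killed (the target has exponent `2`). [cite: Milnor1970, Appendix «k_*F for the algebra K_*F/2K_*F» (p0024 L35–L36)] -/
theorem twoMultiples_le_ker_milnorKHilbertHom : twoMultiples ℚ 2 ≤ milnorKHilbertHom.ker := by
  intro z hz
  obtain ⟨y, rfl⟩ := (mem_twoMultiples_iff ℚ 2).1 hz
  rw [AddMonoidHom.mem_ker, map_zsmul, two_zsmul]
  exact HilbertTargetRat.mul_self _

/-- **The first homomorphism of LEMMA A.1 for `ℚ`: `k₂ℚ → ⊕_v k₂ℚ_v = ⊕_𝔭 {±1}`**, `{a, b} ↦ ((a,b)_𝔭)_𝔭`.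
[cite: Milnor1970, Appendix Lemma A.1 (p0024 L38–L46)] -/
def k2HilbertHom : MilnorK.Mod2 ℚ 2 →+ Additive HilbertTargetRat :=
  QuotientAddGroup.lift (twoMultiples ℚ 2) milnorKHilbertHom twoMultiples_le_ker_milnorKHilbertHom

/-- `k2HilbertHom` on the class of `z ∈ K₂^M ℚ`. [cite: Milnor1970, Appendix Lemma A.1 (p0024 L38–L46)] -/
theorem k2HilbertHom_kmk (z : MilnorK ℚ 2) : k2HilbertHom (kmk ℚ 2 z) = milnorKHilbertHom z := rfl

/-- **«carries each generator l(a)l(b) of k₂F to either 0 or 1 according as the quadratic Hilbert symbol (a, b)_v is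
trivial or not»**: `k2HilbertHom {a, b} = ((a,b)_𝔭)_𝔭`. [cite: Milnor1970, Appendix Lemma A.1 (p0024 L44–L46)] -/
theorem k2HilbertHom_kSymbol (x y : ℚˣ) : k2HilbertHom (kSymbol ![x, y]) = Additive.ofMul (hilbertUnits x y) := by
  rw [kSymbol_def, k2HilbertHom_kmk, milnorKHilbertHom_symbol]

/-- The component at a place of `k2HilbertHom {x, y}` is the Hilbert symbol of the completion, as an integer.
[cite: Milnor1970, Appendix Lemma A.1 (p0024 L44–L46)] -/
theorem coe_k2HilbertHom_kSymbol_inl (v : HeightOneSpectrum (𝓞 ℚ)) (x y : ℚˣ) :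
    (((Additive.toMul (k2HilbertHom (kSymbol ![x, y])) : HilbertTargetRat) : PlaceRat → ℤˣ) (Sum.inl v) : ℤ) =
      hilbertSymbol (v.adicCompletion ℚ) (algebraMap ℚ _ (x : ℚ)) (algebraMap ℚ _ (y : ℚ)) := by
  rw [k2HilbertHom_kSymbol, toMul_ofMul, coe_hilbertUnits_apply, coe_hilbertUnit_inl]

/-- … and at the infinite place. [cite: Milnor1970, Appendix Lemma A.1 (p0024 L44–L46)] -/
theorem coe_k2HilbertHom_kSymbol_inr (w : InfinitePlace ℚ) (x y : ℚˣ) :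
    (((Additive.toMul (k2HilbertHom (kSymbol ![x, y])) : HilbertTargetRat) : PlaceRat → ℤˣ) (Sum.inr w) : ℤ) =
      hilbertSymbol w.Completion (algebraMap ℚ _ (x : ℚ)) (algebraMap ℚ _ (y : ℚ)) := by
  rw [k2HilbertHom_kSymbol, toMul_ofMul, coe_hilbertUnits_apply, coe_hilbertUnit_inr]

/-- **LEMMA A.1 for `ℚ`: `0 → k₂ℚ → ⊕_v k₂ℚ_v` is exact — `k2HilbertHom` is injective.**
[cite: Milnor1970, Appendix Lemma A.1 (p0024 L38–L39)] -/
theorem k2HilbertHom_injective : Function.Injective k2HilbertHom := by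
  refine (injective_iff_map_eq_zero _).2 fun ξ hξ => ?_
  obtain ⟨z, rfl⟩ := kmk_surjective ξ
  rw [k2HilbertHom_kmk, milnorKHilbertHom, AddMonoidHom.comp_apply, AddEquiv.coe_toAddMonoidHom,
    MonoidHom.toAdditive_apply_apply] at hξ
  have h1 : hilbertHomQuot (Additive.toMul (twoEquiv ℚ z)) = 1 := by
    rw [← ofMul_eq_zero, ← hξ]
  obtain ⟨b, hb⟩ := (hilbertHomQuot_eq_one_iff_isSquare _).1 h1
  rw [kmk_eq_zero_iff]
  refine ⟨(twoEquiv ℚ).symm (Additive.ofMul b), ?_⟩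
  apply (twoEquiv ℚ).injective
  rw [map_zsmul, AddEquiv.apply_symm_apply, two_zsmul, ← ofMul_mul, ← hb, ofMul_toMul]

/-- **LEMMA A.1 for `ℚ`: exactness at `⊕_v k₂ℚ_v` — the range of `k2HilbertHom` is the kernel of the product map.**
[cite: Milnor1970, Appendix Lemma A.1 (p0024 L38–L39)] -/
theorem range_k2HilbertHom_eq_ker :
    k2HilbertHom.range = (MonoidHom.toAdditive prodPlaceHom).ker := by
  ext g
  constructor
  · rintro ⟨ξ, rfl⟩
    obtain ⟨z, rfl⟩ := kmk_surjective ξ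
    rw [AddMonoidHom.mem_ker, k2HilbertHom_kmk, milnorKHilbertHom, AddMonoidHom.comp_apply,
      AddEquiv.coe_toAddMonoidHom, MonoidHom.toAdditive_apply_apply, MonoidHom.toAdditive_apply_apply, toMul_ofMul,
      ← MonoidHom.comp_apply, prodPlaceHom_comp_hilbertHomQuot, MonoidHom.one_apply, ofMul_one]
  · intro hg
    rw [AddMonoidHom.mem_ker, MonoidHom.toAdditive_apply_apply, ofMul_eq_zero] at hg
    have hg' : Additive.toMul g ∈ prodPlaceHom.ker := hg
    rw [ker_prodPlaceHom_eq_range_hilbertHomQuot] at hg'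
    obtain ⟨a, ha⟩ := hg'
    refine ⟨kmk ℚ 2 ((twoEquiv ℚ).symm (Additive.ofMul a)), ?_⟩
    rw [k2HilbertHom_kmk, milnorKHilbertHom, AddMonoidHom.comp_apply, AddEquiv.coe_toAddMonoidHom,
      AddEquiv.apply_symm_apply, MonoidHom.toAdditive_apply_apply, toMul_ofMul, ha, ofMul_toMul]

/-- **LEMMA A.1 (Bass–Tate) for `F = ℚ`.** «There is an exact sequence 0 → k₂F → ⊕ k₂F_v → Z/2Z → 0»: with `⊕_v k₂ℚ_v`
read as the families of Hilbert symbols `⊕_𝔭 {±1}` — `k2HilbertHom` is injective, its range is the kernel of the product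
map, and the product map is onto `{±1} ≅ ℤ/2`. [cite: Milnor1970, Appendix Lemma A.1 (p0024 L38–L41)] -/
theorem lemmaA1_rat :
    Function.Injective k2HilbertHom ∧ k2HilbertHom.range = (MonoidHom.toAdditive prodPlaceHom).ker ∧
      Function.Surjective prodPlaceHom :=
  ⟨k2HilbertHom_injective, range_k2HilbertHom_eq_ker, prodPlaceHom_surjective⟩

end ModTwo

end Literature.RingTheory.KTheory
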